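import Summits.QuantumFields.YangMills.Theorems.UnitScaleTiltProp7CminOfP6T3PdS
import Summits.QuantumFields.YangMills.Theorems.UnitScaleTiltProp7SPrintDefsS
import HarnessLib

/-!
# Route `UnitScaleTilt`, crux K1 child «MinimiserStabilityRegPr» (stmt-QuantumFields-19200), skeleton v10, stub `stub_existenceMinimalOrbit` (EX), route (α) — **C-minˢ ⇐ P6@T³
# (PROVED) ∧ CHART-112ˢ (displayed) ∧ THE (α)-CURRENCY CHART ROWS AT THE CRITICAL BACKGROUND `W`** (★★OWNER RULING №26∕№26a, 2026-08-28 10:41∕10:46Z, on ★w4-19200 g4's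
# LOCATE «HGROWTH-PIN»: the displayed (γ)-growth row `hGrowth` of the EX knit — a k-uniform relative Poincaré for the PINNED class `descTransf g = 1` at the curved critical
# background, the same literal shape as route-R's stub P — has no known k-uniform supplier (RULING №25); print's exit is neither horn: chart the competitor AT THE CRITICAL
# BACKGROUND by Thm 2 + (47), where the constraint is LINEAR, the first variation is the identity (141) on the linear slice and all content is P = ½⟨A′, Δ₁A′⟩ (142)).  THIS FILE
# is the (α)-currency copy of ✓`Prop7CminOfP6T3PdG.Cmin_of_P6T3_chart_growth_pd_G`: the row `hGrowth` is REPLACED by the two rows of the reduction (141)–(142) read at the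
# critical background `W = (e^{iX}U₀)^u` — CHART_W (every admissible competitor `X′` of C-min's ball has `A(e^{iX′}U₀) = A(e^{iD}W)` for some Hermitian-traceless `D` in an
# OPAQUE slice `Tsl i W` — [Balaban1985RegularSpaces] Thm 2 at background `W`, the transformation (47) and gauge invariance of (5); ALL size information lives in the slice
# letter) and LOCMIN_W (`A(W) ≤ A(e^{iD}W)` for `D ∈ Tsl i W`: «A′ = 0 is a minimum of 𝒜(A′)» — first variation (141) = 0 on the linear slice, second variation (142)
# `½⟨A′, Δ₁A′⟩` positive definite, third order absorbed).  WHY LOCMIN_W AND NOT A TAYLOR SPLIT (knit ruler's design note, 2026-08-28 11:35Z): ✓`cmin_minimality_of_chartRows`'s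
# split rows EL_W `|ℓ_W(D)| ≤ λΣ‖D‖²` ∧ HESS_W `κΣ‖D‖² ≤ q_W(D)` with the T3W remainder `4800·s·Σ‖D‖²` and L-only constants are NOT k-uniformly inhabitable (★w4-19200 g4 LOCATED
# 11:19Z: the slice gap is `κ₀·ℓ⁻²`, the chart radius `ε·ℓ⁻¹`, `ℓ = L^{K−n}` — one power of `ℓ` short in both terms; ★p1 g12 11:14Z CAUTION: along the lifted near-stabiliser
# rotation only the TOTAL second-order growth is expected to be positive), and the scale-aware interface (★w4's F3 `wilsonAction4_expChart_sub_lin_ge`, HESS_W′ in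
# `Σ_p‖ℒ_p(D)‖²`-form, EL_W at the current rate `e·ℓ⁻³`) is being typed in the α-P lane (OWNER RULING №30 (2)); so the knit displays the STABLE interface LOCMIN_W and the
# α-P lane supplies it by ONE lemma from whichever scale-aware rows it lands.  The knit lineage's LOCATE 11:15Z: `hGrowth` is consumed at exactly one place of the chain
# (`CminOfP6T3PdG` :279), so the swap is local.

Cell `ym3-torus`, width seat `ym-ust-19200-w2` (gen 4; EX knit lineage).  THEOREMS ONLY (0 `def`, 0 `sorry`).  By-name bookkeeping around the PROVED Prop. 6 kernel:
nothing here closes the stub; `--supports stmt-QuantumFields-19200 --as helper`, count-neutral.  YM₃ on T³ is a ladder rung (R3), not the Clay problem; nothing here claims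
the stub, the crux, d = 4 or the mass gap.

THE PRINT ([Balaban1985Variational] p. 299, verbatim): *«To see that U_k is a minimum we apply the whole procedure with the configuration U_k instead of U₀. We get a functional
𝒜(A′) for which the critical configuration is equal to 0. This implies that a differential of 𝒜(A′) at A′ = 0 is equal to ⟨δA′, J⟩ and Eq. (93) has the form ⟨δA′, J⟩ = 0 for
all δA′ : QδA′ = 0, RD*δA′ = 0. (141) Further, let us notice that B = 0, hence the configurations A′ satisfy the same conditions as δA′, and we have ⟨A′, J⟩ = 0. Thus the
expansion (81) for this functional has the form 𝒜(A′) = A(U_k) + ½⟨A′, Δ₁A′⟩ + V(A′). (142) A second order differential at A′ = 0 is given by the quadratic form above, and it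
is positive definite. Hence A′ = 0 is a minimum»*.  The three displayed rows are exactly (47)–(48) at background `W` (CHART_W), (141) (EL_W, in the approximate form that also
covers the (47)-image of the linear slice) and (142)'s positive-definiteness (HESS_W, [Balaban1985BackgroundPropagators] Thms 3.11–3.12).

WHAT IS PROVED.  ★★ **`Cmin_of_P6T3_chart_locmin_pd_W`** — the statement and proof of ✓`Cmin_of_P6T3_chart_growth_pd_G` TOKEN FOR TOKEN except: (i) the growth constants
`CP θ cS` and their hypotheses are replaced by ONE constant `aW > 0` (the chart suppliers' absolute `ε₄`-window at the critical background); (ii) ONE new opaque letter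
`Tsl i W : Set (PBond (P K) 0 → M₂(ℂ))` (the slice at the critical background — print's linear Landau slice `{QA′ = 0, RD*A′ = 0}` read through (47), with its sizes);
(iii) the row `hGrowth` is replaced by TWO rows `hChartW`, `hLocW` carrying `hGrowth`'s antecedent prefix VERBATIM plus `ε₄ ≤ aW`, and concluding CHART_W (∀ admissible `X′`,
`∃ D ∈ Tsl i W`, Hermitian-traceless, `A(e^{iX′}U₀) = A(e^{iD}W)`) resp. LOCMIN_W (`∀ D ∈ Tsl i W`, Hermitian-traceless → `A(W) ≤ A(e^{iD}W)`); (iv) `a₄′ = min{¼, a₃/4,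
(16B₀C₄)⁻¹, α, 2r/3, aW}`; (v) the last proof step is CHART_W ∘ LOCMIN_W with `A(W) = A(e^{iX}U₀)` by gauge invariance of (5) (✓`T4WilsonGaugeFlatDirection.wilsonAction_gaugeAct`).
Conclusion VERBATIM the G file's (minimiser `AvgCondPrintS` + `Lan`, competitors print's `AvgCondPrint` + `IsLandauPrint`).

HONEST SCOPE.  Bookkeeping: the analytic content is in the displayed rows (N06(d = 3) ×2, Prop. 4, (1.37), CHART-112ˢ, CHART_W, LOCMIN_W) and in the PROVED Prop. 6
kernel (✓`Prop7SectET3ObjectsPd.prop6_T3`); count-neutral helper toward stmt-QuantumFields-19200, not a proof of the stub.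

References: T. Bałaban, CMP 102 (1985) 277–309 [Balaban1985Variational] ((14) p.280, (19)–(21) p.281, (47)–(48) p.285, (103) p.293, (111)–(112) p.294, Props 5–6
pp.294–296, (115)–(117) p.295, (141)–(142) p.299, Prop. 7 p.299); CMP 99 (1985) 389–434 [Balaban1985BackgroundPropagators] (Thms 3.11–3.13); CMP 99 (1985) 75–102
[Balaban1985RegularSpaces] ((1.19) p.79, (1.28)–(1.31) pp.81–82, (1.37) p.82, Thm 2 p.83); CMP 98 (1985) 17–51 [Balaban1985Averaging] ((87) p.31).
-/

set_option autoImplicit false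

noncomputable section

open scoped BigOperators Matrix.Norms.L2Operator Matrix

namespace Summit.QuantumFields.YangMills.Theorems.Prop7CminOfP6T3PdW

open Literature.MathematicalPhysics.QuantumFieldTheory.Balaban1983to89
open Literature.MathematicalPhysics.QuantumFieldTheory.Balaban1983to89.T3ContinuumYM3Torus
open Literature.MathematicalPhysics.QuantumFieldTheory.Balaban1983to89.T3UnitLawDensityEML (ℰp)
open Literature.MathematicalPhysics.QuantumFieldTheory.Balaban1983to89.T3ConstrainedMinimiser (fibre)
open Literature.MathematicalPhysics.QuantumFieldTheory.Balaban1983to89.T3PrintedRegularMinimiser (RegPr regFibrePr)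
open Literature.MathematicalPhysics.QuantumFieldTheory.Balaban1983to89.T3PrintedRegularOrbits (descTransf)
open Literature.MathematicalPhysics.QuantumFieldTheory.Balaban1983to89.T3Thm1Carrier
open Literature.MathematicalPhysics.QuantumFieldTheory.Balaban1983to89.T3SectALandauChart (In19 emb15 CloseAvg)
open BlockAveragingEMLLinearisedBackground (pertVar)
open B9SectCLatticeCarrier (Bond)
open B11Eq115Space (NegSize Space115)
open B11Eq111FrakG (nabla115)
open B11Eq98CurrentSlot (Jcur)
open B13Contraction113 (QuadAnalytic)
open Summit.QuantumFields.YangMills.Theorems.Prop7TPrint (nMax19 expHermField expHermField_apply coe_expHerm)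
open Summit.QuantumFields.YangMills.Theorems.Prop7SPrint (AvgCondPrint AvgCondPrintS NormS IsLandauPrint RestrictedPrint IsAxialPrint)
open B4Sect5Torus (TSite)
open B10Eq27TorusAxialLog (unitsField toUField)
open Summit.QuantumFields.YangMills.Theorems.Prop7SectET3ObjectsPd (prop6_T3)

variable {L : ℕ}

/-- ★★ **C-minˢ FROM PROPOSITION 6 AT THE T³ OBJECTS (PROVED), CHART-112ˢ (DISPLAYED) AND THE REDUCTION (141)–(142) AT THE CRITICAL BACKGROUND** (CHART_W ∧ LOCMIN_W)
— the copy of ✓`Cmin_of_P6T3_chart_growth_pd_G` with `hGrowth` replaced (★★OWNER RULINGS №26a ∕ №30 (3)): same letters `𝒢f`, `Wf`, `H₁f`, `Bf`, same rows `norm_G`, `prop4`,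
`norm_H₁`, `bound20`, `hChart`; new opaque letter `Tsl` (the slice at the critical background `W`, sizes included), new rows `hChartW` (every admissible competitor `X′` is,
in action, a chart point: `A(e^{iX′}U₀) = A(e^{iD}W)`, `D ∈ Tsl i W` Hermitian-traceless) and `hLocW` (`A(W) ≤ A(e^{iD}W)` on the slice — «A′ = 0 is a minimum of 𝒜»),
each under `hGrowth`'s antecedents (+ `ε₄ ≤ aW`).  Conclusion: the body of C-minˢ at `(L, B₃)` VERBATIM.
[cite: Balaban1985Variational, Prop. 6 p.295, (112) p.294, (141)-(142) p.299, (47)-(48) p.285, (19)-(21) p.281, (14) p.280, (103) p.293, (5) p.278; Balaban1985RegularSpaces, (1.28)-(1.31) pp.81-82, Thm 2 p.83] -/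
theorem Cmin_of_P6T3_chart_locmin_pd_W (hL : 1 < L) {B₃ : ℝ} (hB₃ : 3 * (L : ℝ) ≤ B₃)
    [hFL : ∀ F : T3Family, Fact (0 < (F.L : ℝ))] [hFη : ∀ (F : T3Family) (k : ℕ), Fact (0 < ((F.L : ℝ)⁻¹) ^ k)]
    (Lan : ∀ i : Idx L, GaugeField (i.1.1.P i.1.2.2) 0 (Matrix.specialUnitaryGroup (Fin 2) ℂ) → (PBond (i.1.1.P i.1.2.2) 0 → Matrix (Fin 2) (Fin 2) ℂ) → Prop)
    -- the lattice periods and the site charts, ABSTRACT (periodsT3 ∕ towerP are instances)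
    (Pd : ∀ i : Idx L, Fin (i.1.1.P i.1.2.2).d → ℕ) (e : ∀ i : Idx L, Site (i.1.1.P i.1.2.2) 0 ≃ TSite (i.1.1.P i.1.2.2).d (Pd i))
    (he : ∀ (i : Idx L) (x : Site (i.1.1.P i.1.2.2) 0) (μ : Fin (i.1.1.P i.1.2.2).d), e i (x.shift μ) = B9Eq33CovDerivVector.shiftEquiv μ (e i x))
    {B₀ C₄ a₃ α r M aW : ℝ} (hB₀ : 0 < B₀) (hC₄ : 0 < C₄) (ha₃ : 0 < a₃) (hα : 0 < α) (hr : 0 < r) (hM : 0 < M)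
    -- the chart suppliers' absolute `ε₄`-window at the critical background
    (haW : 0 < aW)
    -- the curved letters, OPAQUE
    (𝒢f : ∀ (i : Idx L) (U₀ : GaugeField (i.1.1.P i.1.2.2) 0 (Matrix.specialUnitaryGroup (Fin 2) ℂ)),
      NegSize (i.1.1.L : ℝ) (((i.1.1.L : ℝ)⁻¹) ^ (i.1.2.2 - i.1.2.1)) (fun _ : Bond (i.1.1.P i.1.2.2).d (Pd i) => i.1.2.2 - i.1.2.1) 3
          (Matrix (Fin 2) (Fin 2) ℂ) →L[ℂ]
        Space115 (i.1.1.L : ℝ) (((i.1.1.L : ℝ)⁻¹) ^ (i.1.2.2 - i.1.2.1)) (fun _ : Bond (i.1.1.P i.1.2.2).d (Pd i) => i.1.2.2 - i.1.2.1)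
          (fun _ : Bond (i.1.1.P i.1.2.2).d (Pd i) × Fin (i.1.1.P i.1.2.2).d => i.1.2.2 - i.1.2.1) (nabla115 (((i.1.1.L : ℝ)⁻¹) ^ (i.1.2.2 - i.1.2.1)) (fun b : Bond (i.1.1.P i.1.2.2).d (Pd i) => unitsField (toUField U₀) ⟨(e i).symm b.1, b.2⟩)))
    (Wf : ∀ (i : Idx L) (U₀ : GaugeField (i.1.1.P i.1.2.2) 0 (Matrix.specialUnitaryGroup (Fin 2) ℂ)),
      Space115 (i.1.1.L : ℝ) (((i.1.1.L : ℝ)⁻¹) ^ (i.1.2.2 - i.1.2.1)) (fun _ : Bond (i.1.1.P i.1.2.2).d (Pd i) => i.1.2.2 - i.1.2.1)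
          (fun _ : Bond (i.1.1.P i.1.2.2).d (Pd i) × Fin (i.1.1.P i.1.2.2).d => i.1.2.2 - i.1.2.1) (nabla115 (((i.1.1.L : ℝ)⁻¹) ^ (i.1.2.2 - i.1.2.1)) (fun b : Bond (i.1.1.P i.1.2.2).d (Pd i) => unitsField (toUField U₀) ⟨(e i).symm b.1, b.2⟩)) →
        NegSize (i.1.1.L : ℝ) (((i.1.1.L : ℝ)⁻¹) ^ (i.1.2.2 - i.1.2.1)) (fun _ : Bond (i.1.1.P i.1.2.2).d (Pd i) => i.1.2.2 - i.1.2.1) 3 (Matrix (Fin 2) (Fin 2) ℂ))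
    (β : Idx L → Type) [∀ i, Fintype (β i)]
    (H₁f : ∀ (i : Idx L) (U₀ : GaugeField (i.1.1.P i.1.2.2) 0 (Matrix.specialUnitaryGroup (Fin 2) ℂ)),
      (β i → Matrix (Fin 2) (Fin 2) ℂ) →L[ℂ]
        Space115 (i.1.1.L : ℝ) (((i.1.1.L : ℝ)⁻¹) ^ (i.1.2.2 - i.1.2.1)) (fun _ : Bond (i.1.1.P i.1.2.2).d (Pd i) => i.1.2.2 - i.1.2.1)
          (fun _ : Bond (i.1.1.P i.1.2.2).d (Pd i) × Fin (i.1.1.P i.1.2.2).d => i.1.2.2 - i.1.2.1) (nabla115 (((i.1.1.L : ℝ)⁻¹) ^ (i.1.2.2 - i.1.2.1)) (fun b : Bond (i.1.1.P i.1.2.2).d (Pd i) => unitsField (toUField U₀) ⟨(e i).symm b.1, b.2⟩)))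
    (Bf : ∀ (i : Idx L), GaugeField (i.1.1.P i.1.2.1) 0 (Matrix.specialUnitaryGroup (Fin 2) ℂ) → GaugeField (i.1.1.P i.1.2.2) 0 (Matrix.specialUnitaryGroup (Fin 2) ℂ) →
      β i → Matrix (Fin 2) (Fin 2) ℂ)
    -- the slice at the critical background `W`, OPAQUE (print's linear Landau slice `{QA′ = 0, RD*A′ = 0}` at background `W`, read through (47))
    (Tsl : ∀ (i : Idx L), GaugeField (i.1.1.P i.1.2.2) 0 (Matrix.specialUnitaryGroup (Fin 2) ℂ) → Set (PBond (i.1.1.P i.1.2.2) 0 → Matrix (Fin 2) (Fin 2) ℂ))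
    -- their displayed bounds (the `SectEDatum` fields at admissible backgrounds)
    (norm_G : ∀ (i : Idx L) (e : ℝ) (U₀ : GaugeField (i.1.1.P i.1.2.2) 0 (Matrix.specialUnitaryGroup (Fin 2) ℂ)),
      RegPr i.1.1 i.1.2.1 i.1.2.2 e U₀ → e ≤ α → ∀ f, ‖𝒢f i U₀ f‖ ≤ B₀ * ‖f‖)
    (prop4 : ∀ (i : Idx L) (e : ℝ) (U₀ : GaugeField (i.1.1.P i.1.2.2) 0 (Matrix.specialUnitaryGroup (Fin 2) ℂ)),
      RegPr i.1.1 i.1.2.1 i.1.2.2 e U₀ → e ≤ α → QuadAnalytic (Wf i U₀) C₄ a₃)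
    (norm_H₁ : ∀ (i : Idx L) (e : ℝ) (U₀ : GaugeField (i.1.1.P i.1.2.2) 0 (Matrix.specialUnitaryGroup (Fin 2) ℂ)),
      RegPr i.1.1 i.1.2.1 i.1.2.2 e U₀ → e ≤ α → ∀ b, ‖H₁f i U₀ b‖ ≤ B₀ * ‖b‖)
    (bound20 : ∀ (i : Idx L) (ε₁ : ℝ) (V : GaugeField (i.1.1.P i.1.2.1) 0 (Matrix.specialUnitaryGroup (Fin 2) ℂ))
      (U₀ : GaugeField (i.1.1.P i.1.2.2) 0 (Matrix.specialUnitaryGroup (Fin 2) ℂ)), 0 < ε₁ → PlaqSmall ε₁ V →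
      RegPr i.1.1 i.1.2.1 i.1.2.2 ((L : ℝ) ^ 3 * B₃ * ε₁) U₀ → CloseAvg i.1.1 i.1.2.1 i.1.2.2 i.2.2.le ((L : ℝ) ^ 3 * ε₁) V U₀ →
      ‖Bf i V U₀‖ < 2 * ((3 : ℝ) * i.1.1.L) * ((L : ℝ) ^ 3 * ε₁))
    -- (i) CHART-112, displayed
    (hChart : ∀ (i : Idx L) (ε₁ : ℝ) (V : GaugeField (i.1.1.P i.1.2.1) 0 (Matrix.specialUnitaryGroup (Fin 2) ℂ))
      (U₀ : GaugeField (i.1.1.P i.1.2.2) 0 (Matrix.specialUnitaryGroup (Fin 2) ℂ)), 0 < ε₁ → PlaqSmall ε₁ V →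
      RegPr i.1.1 i.1.2.1 i.1.2.2 ((L : ℝ) ^ 3 * B₃ * ε₁) U₀ → CloseAvg i.1.1 i.1.2.1 i.1.2.2 i.2.2.le ((L : ℝ) ^ 3 * ε₁) V U₀ → (L : ℝ) ^ 3 * B₃ * ε₁ ≤ α →
      ∀ A₁ : Space115 (i.1.1.L : ℝ) (((i.1.1.L : ℝ)⁻¹) ^ (i.1.2.2 - i.1.2.1)) (fun _ : Bond (i.1.1.P i.1.2.2).d (Pd i) => i.1.2.2 - i.1.2.1)
          (fun _ : Bond (i.1.1.P i.1.2.2).d (Pd i) × Fin (i.1.1.P i.1.2.2).d => i.1.2.2 - i.1.2.1) (nabla115 (((i.1.1.L : ℝ)⁻¹) ^ (i.1.2.2 - i.1.2.1)) (fun b : Bond (i.1.1.P i.1.2.2).d (Pd i) => unitsField (toUField U₀) ⟨(e i).symm b.1, b.2⟩)),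
        ‖A₁‖ < r → A₁ + 𝒢f i U₀ (Jcur (fun b : Bond (i.1.1.P i.1.2.2).d (Pd i) => unitsField (toUField U₀) ⟨(e i).symm b.1, b.2⟩)) + 𝒢f i U₀ (Wf i U₀ (A₁ + H₁f i U₀ (Bf i V U₀))) = 0 →
        ∃ X : PBond (i.1.1.P i.1.2.2) 0 → Matrix (Fin 2) (Fin 2) ℂ,
          (∀ b : PBond (i.1.1.P i.1.2.2) 0, (X b).IsHermitian ∧ Matrix.trace (X b) = 0) ∧
          nMax19 i.1.1 i.1.2.1 i.1.2.2 U₀ X ≤ M * (‖A₁‖ + ‖H₁f i U₀ (Bf i V U₀)‖) ∧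
          AvgCondPrintS i.1.1 i.1.2.1 i.1.2.2 i.2.2.le V U₀ X ∧ Lan i U₀ X ∧
          (∀ u : GaugeTransf (i.1.1.P i.1.2.2) 0 (Matrix.specialUnitaryGroup (Fin 2) ℂ), NormS i.1.1 i.1.2.1 i.1.2.2 i.2.2.le U₀ X (expHermField X) u →
            GaugeField.gaugeAct u (emb15 U₀ (expHermField X)) ∈ fibre i.1.1 ℰp i.1.2.1 i.1.2.2 i.2.2.le V →
            ∀ γ : ℝ → GaugeField (i.1.1.P i.1.2.2) 0 (Matrix.specialUnitaryGroup (Fin 2) ℂ), γ 0 = GaugeField.gaugeAct u (emb15 U₀ (expHermField X)) →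
              (∀ t, γ t ∈ fibre i.1.1 ℰp i.1.2.1 i.1.2.2 i.2.2.le V) →
              (∀ b, DifferentiableAt ℝ (fun t => ((γ t b : Matrix.specialUnitaryGroup (Fin 2) ℂ) : Matrix (Fin 2) (Fin 2) ℂ)) 0) →
                deriv (fun t => wilsonAction4 (γ t)) 0 = 0))
    -- (ii-a) CHART_W at the critical background `W = (e^{iX}U₀)^u`: every admissible competitor has the action of a chart point `e^{iD}W`, `D` in the slice `Tsl i W` (all size information lives in
    -- the opaque slice letter) — [Balaban1985RegularSpaces] Thm 2 + (47) at background `W` + gauge invariance of (5), DISPLAYED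
    (hChartW : ∀ (i : Idx L) (ε₁ ε₄ : ℝ) (V : GaugeField (i.1.1.P i.1.2.1) 0 (Matrix.specialUnitaryGroup (Fin 2) ℂ))
      (U₀ : GaugeField (i.1.1.P i.1.2.2) 0 (Matrix.specialUnitaryGroup (Fin 2) ℂ)) (X : PBond (i.1.1.P i.1.2.2) 0 → Matrix (Fin 2) (Fin 2) ℂ)
      (u : GaugeTransf (i.1.1.P i.1.2.2) 0 (Matrix.specialUnitaryGroup (Fin 2) ℂ)) (W : GaugeField (i.1.1.P i.1.2.2) 0 (Matrix.specialUnitaryGroup (Fin 2) ℂ)),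
      0 < ε₁ → ε₄ ≤ 1 / 4 → ε₄ ≤ aW → (L : ℝ) ^ 3 * B₃ * ε₁ ≤ ε₄ → PlaqSmall ε₁ V → RegPr i.1.1 i.1.2.1 i.1.2.2 ((L : ℝ) ^ 3 * B₃ * ε₁) U₀ →
      CloseAvg i.1.1 i.1.2.1 i.1.2.2 i.2.2.le ((L : ℝ) ^ 3 * ε₁) V U₀ → (∀ b : PBond (i.1.1.P i.1.2.2) 0, (X b).IsHermitian ∧ Matrix.trace (X b) = 0) →
      nMax19 i.1.1 i.1.2.1 i.1.2.2 U₀ X < ε₄ → AvgCondPrintS i.1.1 i.1.2.1 i.1.2.2 i.2.2.le V U₀ X → Lan i U₀ X →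
      NormS i.1.1 i.1.2.1 i.1.2.2 i.2.2.le U₀ X (expHermField X) u → W = GaugeField.gaugeAct u (emb15 U₀ (expHermField X)) →
      W ∈ fibre i.1.1 ℰp i.1.2.1 i.1.2.2 i.2.2.le V →
      (∀ γ : ℝ → GaugeField (i.1.1.P i.1.2.2) 0 (Matrix.specialUnitaryGroup (Fin 2) ℂ), γ 0 = W → (∀ t, γ t ∈ fibre i.1.1 ℰp i.1.2.1 i.1.2.2 i.2.2.le V) →
        (∀ b, DifferentiableAt ℝ (fun t => ((γ t b : Matrix.specialUnitaryGroup (Fin 2) ℂ) : Matrix (Fin 2) (Fin 2) ℂ)) 0) →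
          deriv (fun t => wilsonAction4 (γ t)) 0 = 0) →
      ∀ X' : PBond (i.1.1.P i.1.2.2) 0 → Matrix (Fin 2) (Fin 2) ℂ, nMax19 i.1.1 i.1.2.1 i.1.2.2 U₀ X' < ε₄ →
        (∀ b : PBond (i.1.1.P i.1.2.2) 0, (X' b).IsHermitian ∧ Matrix.trace (X' b) = 0) →
          AvgCondPrint i.1.1 i.1.2.1 i.1.2.2 i.2.2.le V U₀ X' → IsLandauPrint i.1.1 i.1.2.1 i.1.2.2 U₀ X' →
            ∃ D ∈ Tsl i W, (∀ b : PBond (i.1.1.P i.1.2.2) 0, (D b).IsHermitian ∧ Matrix.trace (D b) = 0) ∧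
              wilsonAction4 (emb15 U₀ (expHermField X')) = wilsonAction4 (emb15 W (expHermField D)))
    -- (ii-b) LOCMIN_W: `W` is a minimum of the action along the charted slice — (141)–(142) at the critical background: first variation = 0 on the linear slice, second variation
    -- `½⟨A′, Δ₁A′⟩` positive definite, third order absorbed (DISPLAYED; the α-P lane's row: TAYLOR ∧ EL_W ∧ HESS_W in their scale-aware shapes ⟹ LOCMIN_W)
    (hLocW : ∀ (i : Idx L) (ε₁ ε₄ : ℝ) (V : GaugeField (i.1.1.P i.1.2.1) 0 (Matrix.specialUnitaryGroup (Fin 2) ℂ))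
      (U₀ : GaugeField (i.1.1.P i.1.2.2) 0 (Matrix.specialUnitaryGroup (Fin 2) ℂ)) (X : PBond (i.1.1.P i.1.2.2) 0 → Matrix (Fin 2) (Fin 2) ℂ)
      (u : GaugeTransf (i.1.1.P i.1.2.2) 0 (Matrix.specialUnitaryGroup (Fin 2) ℂ)) (W : GaugeField (i.1.1.P i.1.2.2) 0 (Matrix.specialUnitaryGroup (Fin 2) ℂ)),
      0 < ε₁ → ε₄ ≤ 1 / 4 → ε₄ ≤ aW → (L : ℝ) ^ 3 * B₃ * ε₁ ≤ ε₄ → PlaqSmall ε₁ V → RegPr i.1.1 i.1.2.1 i.1.2.2 ((L : ℝ) ^ 3 * B₃ * ε₁) U₀ →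
      CloseAvg i.1.1 i.1.2.1 i.1.2.2 i.2.2.le ((L : ℝ) ^ 3 * ε₁) V U₀ → (∀ b : PBond (i.1.1.P i.1.2.2) 0, (X b).IsHermitian ∧ Matrix.trace (X b) = 0) →
      nMax19 i.1.1 i.1.2.1 i.1.2.2 U₀ X < ε₄ → AvgCondPrintS i.1.1 i.1.2.1 i.1.2.2 i.2.2.le V U₀ X → Lan i U₀ X →
      NormS i.1.1 i.1.2.1 i.1.2.2 i.2.2.le U₀ X (expHermField X) u → W = GaugeField.gaugeAct u (emb15 U₀ (expHermField X)) →
      W ∈ fibre i.1.1 ℰp i.1.2.1 i.1.2.2 i.2.2.le V →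
      (∀ γ : ℝ → GaugeField (i.1.1.P i.1.2.2) 0 (Matrix.specialUnitaryGroup (Fin 2) ℂ), γ 0 = W → (∀ t, γ t ∈ fibre i.1.1 ℰp i.1.2.1 i.1.2.2 i.2.2.le V) →
        (∀ b, DifferentiableAt ℝ (fun t => ((γ t b : Matrix.specialUnitaryGroup (Fin 2) ℂ) : Matrix (Fin 2) (Fin 2) ℂ)) 0) →
          deriv (fun t => wilsonAction4 (γ t)) 0 = 0) →
      ∀ D ∈ Tsl i W, (∀ b : PBond (i.1.1.P i.1.2.2) 0, (D b).IsHermitian ∧ Matrix.trace (D b) = 0) →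
        wilsonAction4 W ≤ wilsonAction4 (emb15 W (expHermField D))) :
    ∃ B₀' a₄' : ℝ, 0 < B₀' ∧ 0 < a₄' ∧ ∀ (i : Idx L) (ε₁ ε₄ : ℝ), 0 < ε₁ → ε₄ ≤ a₄' → 2 * B₀' * (L : ℝ) ^ 3 * B₃ * ε₁ ≤ ε₄ →
        ∀ (V : GaugeField (i.1.1.P i.1.2.1) 0 (Matrix.specialUnitaryGroup (Fin 2) ℂ)) (U₀ : GaugeField (i.1.1.P i.1.2.2) 0 (Matrix.specialUnitaryGroup (Fin 2) ℂ)),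
          PlaqSmall ε₁ V → RegPr i.1.1 i.1.2.1 i.1.2.2 ((L : ℝ) ^ 3 * B₃ * ε₁) U₀ → CloseAvg i.1.1 i.1.2.1 i.1.2.2 i.2.2.le ((L : ℝ) ^ 3 * ε₁) V U₀ →
          ∃ X : PBond (i.1.1.P i.1.2.2) 0 → Matrix (Fin 2) (Fin 2) ℂ,
            nMax19 i.1.1 i.1.2.1 i.1.2.2 U₀ X < 3 * B₀' * (L : ℝ) ^ 3 * B₃ * ε₁ ∧ (∀ b : PBond (i.1.1.P i.1.2.2) 0, (X b).IsHermitian ∧ Matrix.trace (X b) = 0) ∧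
            AvgCondPrintS i.1.1 i.1.2.1 i.1.2.2 i.2.2.le V U₀ X ∧ Lan i U₀ X ∧
            ∀ X' : PBond (i.1.1.P i.1.2.2) 0 → Matrix (Fin 2) (Fin 2) ℂ, nMax19 i.1.1 i.1.2.1 i.1.2.2 U₀ X' < ε₄ → (∀ b : PBond (i.1.1.P i.1.2.2) 0, (X' b).IsHermitian ∧ Matrix.trace (X' b) = 0) →
              AvgCondPrint i.1.1 i.1.2.1 i.1.2.2 i.2.2.le V U₀ X' → IsLandauPrint i.1.1 i.1.2.1 i.1.2.2 U₀ X' →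
                wilsonAction4 (emb15 U₀ (expHermField X)) ≤ wilsonAction4 (emb15 U₀ (expHermField X')) := by
  have hL1 : (1 : ℝ) ≤ (L : ℝ) := by exact_mod_cast hL.le
  have hL0 : (0 : ℝ) < (L : ℝ) := by positivity
  have hL3 : (0 : ℝ) < (L : ℝ) ^ 3 := by positivity
  have hB₃0 : 0 < B₃ := lt_of_lt_of_le (by positivity) hB₃
  -- the constants of C-min
  set B₀' : ℝ := max (max B₀ (5 * M * B₀ / 2)) (1 / 2) with hB₀'_def
  have hB₀le : B₀ ≤ B₀' := (le_max_left _ _).trans (le_max_left _ _)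
  have h5M : 5 * M * B₀ / 2 ≤ B₀' := (le_max_right _ _).trans (le_max_left _ _)
  have hhalf : 1 / 2 ≤ B₀' := le_max_right _ _
  have hB₀'0 : 0 < B₀' := lt_of_lt_of_le (by norm_num) hhalf
  set a₄' : ℝ := min (min (min (min (min (1 / 4) (a₃ / 4)) (1 / (16 * B₀ * C₄))) α) (2 * r / 3)) aW with ha₄'_def
  have ha₄'0 : 0 < a₄' :=
    lt_min (lt_min (lt_min (lt_min (lt_min (by norm_num) (by positivity)) (by positivity)) hα) (by positivity)) haW
  have ha1 : a₄' ≤ 1 / 4 := (min_le_left _ _).trans ((min_le_left _ _).trans ((min_le_left _ _).trans ((min_le_left _ _).trans (min_le_left _ _))))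
  have ha2 : a₄' ≤ a₃ / 4 := (min_le_left _ _).trans ((min_le_left _ _).trans ((min_le_left _ _).trans ((min_le_left _ _).trans (min_le_right _ _))))
  have ha3 : a₄' ≤ 1 / (16 * B₀ * C₄) := (min_le_left _ _).trans ((min_le_left _ _).trans ((min_le_left _ _).trans (min_le_right _ _)))
  have ha4 : a₄' ≤ α := (min_le_left _ _).trans ((min_le_left _ _).trans (min_le_right _ _))
  have ha5 : a₄' ≤ 2 * r / 3 := (min_le_left _ _).trans (min_le_right _ _)
  have ha6 : a₄' ≤ aW := min_le_right _ _
  refine ⟨B₀', a₄', hB₀'0, ha₄'0, ?_⟩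
  intro i ε₁ ε₄ hε₁ hε₄a h2B V U₀ hV hreg hclose
  have hFL' : (i.1.1.L : ℝ) = (L : ℝ) := by exact_mod_cast i.2.1
  have hP0 : 0 ≤ (L : ℝ) ^ 3 * B₃ * ε₁ := by positivity
  -- the smallness facts carried by `2B₀′L³B₃ε₁ ≤ ε₄ ≤ a₄′`
  have hε₄4 : ε₄ ≤ 1 / 4 := hε₄a.trans ha1
  have hlo : (L : ℝ) ^ 3 * B₃ * ε₁ ≤ ε₄ := by
    have h' : (1 : ℝ) * ((L : ℝ) ^ 3 * B₃ * ε₁) ≤ (2 * B₀') * ((L : ℝ) ^ 3 * B₃ * ε₁) := mul_le_mul_of_nonneg_right (by linarith) hP0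
    linarith
  have h2B₀ : 2 * B₀ * (L : ℝ) ^ 3 * B₃ * ε₁ ≤ ε₄ := by
    have h' : (2 * B₀) * ((L : ℝ) ^ 3 * B₃ * ε₁) ≤ (2 * B₀') * ((L : ℝ) ^ 3 * B₃ * ε₁) := mul_le_mul_of_nonneg_right (by linarith) hP0
    linarith
  have hαe : (L : ℝ) ^ 3 * B₃ * ε₁ ≤ α := hlo.trans (hε₄a.trans ha4)
  have h2 : 4 * (2 * B₀ * (L : ℝ) ^ 3 * B₃ * ε₁) ≤ a₃ := by linarith [hε₄a.trans ha2]
  have h3 : 16 * B₀ * C₄ * (2 * B₀ * (L : ℝ) ^ 3 * B₃ * ε₁) ≤ 1 := by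
    have hBC : 0 < 16 * B₀ * C₄ := by positivity
    have h' : 2 * B₀ * (L : ℝ) ^ 3 * B₃ * ε₁ ≤ 1 / (16 * B₀ * C₄) := h2B₀.trans (hε₄a.trans ha3)
    calc 16 * B₀ * C₄ * (2 * B₀ * (L : ℝ) ^ 3 * B₃ * ε₁) ≤ 16 * B₀ * C₄ * (1 / (16 * B₀ * C₄)) := mul_le_mul_of_nonneg_left h' hBC.le
      _ = 1 := by field_simp
  have hdLB₃ : (3 : ℝ) * i.1.1.L ≤ B₃ := by rw [hFL']; exact hB₃
  have hregF : RegPr i.1.1 i.1.2.1 i.1.2.2 ((i.1.1.L : ℝ) ^ 3 * B₃ * ε₁) U₀ := by rw [hFL']; exact hreg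
  have hloF : (i.1.1.L : ℝ) ^ 3 * B₃ * ε₁ ≤ ε₄ := by rw [hFL']; exact hlo
  -- the letters' bounds at this admissible background
  have h𝒢 := norm_G i _ U₀ hreg hαe
  have hW := prop4 i _ U₀ hreg hαe
  have hH₁ := norm_H₁ i _ U₀ hreg hαe
  have hB := bound20 i ε₁ V U₀ hε₁ hV hreg hclose
  -- (103): the datum `H₁B`
  have hH₁B_lt : ‖H₁f i U₀ (Bf i V U₀)‖ < 2 * ((3 : ℝ) * i.1.1.L) * B₀ * (L : ℝ) ^ 3 * ε₁ :=
    calc ‖H₁f i U₀ (Bf i V U₀)‖ ≤ B₀ * ‖Bf i V U₀‖ := hH₁ (Bf i V U₀)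
      _ < B₀ * (2 * ((3 : ℝ) * i.1.1.L) * ((L : ℝ) ^ 3 * ε₁)) := mul_lt_mul_of_pos_left hB hB₀
      _ = 2 * ((3 : ℝ) * i.1.1.L) * B₀ * (L : ℝ) ^ 3 * ε₁ := by ring
  have hH₁B_le : ‖H₁f i U₀ (Bf i V U₀)‖ ≤ 2 * B₀ * (L : ℝ) ^ 3 * B₃ * ε₁ := by
    have h6 : 2 * ((3 : ℝ) * i.1.1.L) * B₀ * (L : ℝ) ^ 3 * ε₁ ≤ 2 * B₀ * (L : ℝ) ^ 3 * B₃ * ε₁ := by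
      have h3L : (3 : ℝ) * i.1.1.L ≤ B₃ := hdLB₃
      have hc : 0 ≤ 2 * B₀ * (L : ℝ) ^ 3 * ε₁ := by positivity
      calc 2 * ((3 : ℝ) * i.1.1.L) * B₀ * (L : ℝ) ^ 3 * ε₁ = ((3 : ℝ) * i.1.1.L) * (2 * B₀ * (L : ℝ) ^ 3 * ε₁) := by ring
        _ ≤ B₃ * (2 * B₀ * (L : ℝ) ^ 3 * ε₁) := mul_le_mul_of_nonneg_right h3L hc
        _ = 2 * B₀ * (L : ℝ) ^ 3 * B₃ * ε₁ := by ring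
    exact hH₁B_lt.le.trans h6
  -- PROPOSITION 6 at the T³ objects (PROVED): the solution `A₁` in the (115)-ball `2B₀L³B₃ε₁`
  obtain ⟨A₁, _hA₁ε, hsol, hA₁3, -⟩ := prop6_T3 (n := i.1.2.1) (e i) (he i) (C₁ := (L : ℝ) ^ 3) (ε₄ := 2 * B₀ * (L : ℝ) ^ 3 * B₃ * ε₁) U₀
    (𝒢 := 𝒢f i U₀) (W := Wf i U₀) h𝒢 hW hB₀ hC₄ hL3 hB₃0 hε₁ hdLB₃ le_rfl h2 h3 hreg (𝔄 := H₁f i U₀ (Bf i V U₀)) hH₁B_lt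
  -- CHART-112 (displayed): the exponent `X`
  have hA₁r : ‖A₁‖ < r := by
    have : 3 * B₀ * (L : ℝ) ^ 3 * B₃ * ε₁ ≤ r := by linarith [hε₄a.trans ha5]
    exact hA₁3.trans_le this
  obtain ⟨X, hXh, hXM, h20, h21, hEL⟩ := hChart i ε₁ V U₀ hε₁ hV hreg hclose hαe A₁ hA₁r hsol
  have hX5 : nMax19 i.1.1 i.1.2.1 i.1.2.2 U₀ X < 5 * M * B₀ * (L : ℝ) ^ 3 * B₃ * ε₁ := by
    have hsum : ‖A₁‖ + ‖H₁f i U₀ (Bf i V U₀)‖ < 5 * B₀ * (L : ℝ) ^ 3 * B₃ * ε₁ := by linarith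
    calc nMax19 i.1.1 i.1.2.1 i.1.2.2 U₀ X ≤ M * (‖A₁‖ + ‖H₁f i U₀ (Bf i V U₀)‖) := hXM
      _ < M * (5 * B₀ * (L : ℝ) ^ 3 * B₃ * ε₁) := mul_lt_mul_of_pos_left hsum hM
      _ = 5 * M * B₀ * (L : ℝ) ^ 3 * B₃ * ε₁ := by ring
  have h52 : 5 * M * B₀ * (L : ℝ) ^ 3 * B₃ * ε₁ ≤ 2 * B₀' * (L : ℝ) ^ 3 * B₃ * ε₁ := by
    have h' : (5 * M * B₀) * ((L : ℝ) ^ 3 * B₃ * ε₁) ≤ (2 * B₀') * ((L : ℝ) ^ 3 * B₃ * ε₁) := mul_le_mul_of_nonneg_right (by linarith) hP0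
    linarith
  have h23 : 2 * B₀' * (L : ℝ) ^ 3 * B₃ * ε₁ ≤ 3 * B₀' * (L : ℝ) ^ 3 * B₃ * ε₁ := by
    have h' : (2 * B₀') * ((L : ℝ) ^ 3 * B₃ * ε₁) ≤ (3 * B₀') * ((L : ℝ) ^ 3 * B₃ * ε₁) := mul_le_mul_of_nonneg_right (by linarith) hP0
    linarith
  have hX2 : nMax19 i.1.1 i.1.2.1 i.1.2.2 U₀ X < 2 * B₀' * (L : ℝ) ^ 3 * B₃ * ε₁ := hX5.trans_le h52
  have hX3 : nMax19 i.1.1 i.1.2.1 i.1.2.2 U₀ X < 3 * B₀' * (L : ℝ) ^ 3 * B₃ * ε₁ := hX2.trans_le h23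
  have hXε : nMax19 i.1.1 i.1.2.1 i.1.2.2 U₀ X < ε₄ := hX2.trans_le h2B
  refine ⟨X, hX3, hXh, h20, h21, ?_⟩
  -- the `NormS`-representative `W = (e^{iX}U₀)^u ∈ 𝔅_k(V)` from the re-based (20)
  have hexp : ∀ b : PBond (i.1.1.P i.1.2.2) 0,
      ((expHermField X b : Matrix.specialUnitaryGroup (Fin 2) ℂ) : Matrix (Fin 2) (Fin 2) ℂ) = NormedSpace.exp (Complex.I • X b) := fun b => by
    rw [expHermField_apply, coe_expHerm (hXh b)]
  obtain ⟨u, hu, hWfib⟩ := h20 (expHermField X) hexp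
  -- THE CHART ROWS AT THE CRITICAL BACKGROUND `W = (e^{iX}U₀)^u` (CHART_W ∧ LOCMIN_W; `A(W) = A(e^{iX}U₀)` by gauge invariance)
  have hε₄W : ε₄ ≤ aW := hε₄a.trans ha6
  have hcentre : wilsonAction4 (GaugeField.gaugeAct u (emb15 U₀ (expHermField X))) = wilsonAction4 (emb15 U₀ (expHermField X)) :=
    T4WilsonGaugeFlatDirection.wilsonAction_gaugeAct 1 u _
  -- CHART_W ∘ LOCMIN_W: every admissible competitor is (in action) a chart point `e^{iD}W` of the slice, where `W` is a minimum
  intro X' hX'ε hX'h h20' h21'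
  obtain ⟨D, hDT, hDh, hA⟩ :=
    hChartW i ε₁ ε₄ V U₀ X u _ hε₁ hε₄4 hε₄W hlo hV hreg hclose hXh hXε h20 h21 hu rfl hWfib (hEL u hu hWfib) X' hX'ε hX'h h20' h21'
  rw [hA, ← hcentre]
  exact hLocW i ε₁ ε₄ V U₀ X u _ hε₁ hε₄4 hε₄W hlo hV hreg hclose hXh hXε h20 h21 hu rfl hWfib (hEL u hu hWfib) D hDT hDh

end Summit.QuantumFields.YangMills.Theorems.Prop7CminOfP6T3PdW

end
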